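import Summits.HubbardSuperconductivity.HubbardSuperconductivity.Theorems.AnisotropyChordTransferFibre3FinX3Eval

/-!
# Route `AnisotropyChord` / H0 rotor rung: FIN per-`L` GM₃ (X5), `L = 35` — rows `N₁` / D / side-condition cell facts, part `p20`

Kernel facts (`decide +kernel`) for cert cells 60, 61 of the per-`L` grid of `L = 35`: `xbnCellAny2` (row `N₁` on XB2 point wedges recomputed in the kernel, exporting the literal brackets `nt ⊇ T⁺ − 3λ₂` and `tb ⊇ T⁺·D`), `xdCellAnyN0` (row D, reads `nt`), `sdCellAnyZN` (side condition, reads `nt`); evaluators `…FinX3Eval` / `…FinX5Eval`; constants from the compiled design probe (x3probe/x3plan, margins c ×0.985, b ×1.03, aD ×1.03); assembled in `…FinX5GM3ThirtyFive`.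
Prover seat `hubbard-h0-rotor-p3` g8; helper for piece A = stmt-HubbardSuperconductivity-23918 of rung 19089 (`--supports`, helper class).
WHAT THIS IS NOT: nothing here proves superconductivity in the Hubbard model (rotor TARGET as worded stays FALSE, g15 verdict); kernel facts for the FIN certificate of ONE conditional reduction.  Tree imports only; zero data; standard axioms.
-/

set_option linter.dupNamespace false
set_option autoImplicit false

namespace Summit.HubbardSuperconductivity.HubbardSuperconductivity.Theorems.AnisotropyChord.Transfer.Fibre3

namespace FinXD

open FinXB FinCell Hole2

set_option maxHeartbeats 4000000 in
/-- row `N₁` of cell 60 of `L = 35` (`c = 123/200`), exporting `nt`, `tb`. [folklore] -/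
theorem xn35_60 : xbnCellAny2 35 (49/50 : ℚ) 187262221197261 191943776727193 (123/200 : ℚ) ((-852117552787 : ℤ), (1230945645499 : ℤ)) ((560931117165316 : ℤ), (577065704700758 : ℤ)) = true := by decide +kernel

set_option maxHeartbeats 4000000 in
/-- row D of cell 60 of `L = 35` (`aD = 43/500`). [folklore] -/
theorem xd35_60 : xdCellAnyN0 35 (49/50 : ℚ) 187262221197261 191943776727193 (43/500 : ℚ) ((-852117552787 : ℤ), (1230945645499 : ℤ)) = true := by decide +kernel

set_option maxHeartbeats 4000000 in
/-- side condition of cell 60 of `L = 35` (`c, b = 59/100, aD`). [folklore] -/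
theorem sd35_60 : sdCellAnyZN 35 (49/50 : ℚ) 100 187262221197261 191943776727193 ((123/200 : ℚ), (59 : ℕ), (43/500 : ℚ)) ((-852117552787 : ℤ), (1230945645499 : ℤ)) = true := by decide +kernel

set_option maxHeartbeats 4000000 in
/-- row `N₁` of cell 61 of `L = 35` (`c = 123/200`), exporting `nt`, `tb`. [folklore] -/
theorem xn35_61 : xbnCellAny2 35 (49/50 : ℚ) 191943776727193 196742371145374 (123/200 : ℚ) ((-834065809606 : ℤ), (1242618541258 : ℤ)) ((574993749776452 : ℤ), (591473246572901 : ℤ)) = true := by decide +kernel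

set_option maxHeartbeats 4000000 in
/-- row D of cell 61 of `L = 35` (`aD = 43/500`). [folklore] -/
theorem xd35_61 : xdCellAnyN0 35 (49/50 : ℚ) 191943776727193 196742371145374 (43/500 : ℚ) ((-834065809606 : ℤ), (1242618541258 : ℤ)) = true := by decide +kernel

set_option maxHeartbeats 4000000 in
/-- side condition of cell 61 of `L = 35` (`c, b = 59/100, aD`). [folklore] -/
theorem sd35_61 : sdCellAnyZN 35 (49/50 : ℚ) 100 191943776727193 196742371145374 ((123/200 : ℚ), (59 : ℕ), (43/500 : ℚ)) ((-834065809606 : ℤ), (1242618541258 : ℤ)) = true := by decide +kernel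

end FinXD

end Summit.HubbardSuperconductivity.HubbardSuperconductivity.Theorems.AnisotropyChord.Transfer.Fibre3
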